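import Mathlib.Analysis.Calculus.ParametricIntegral
import Literature.NumberTheory.Automorphic.HarishChandraConvolutionGL
import Literature.NumberTheory.Automorphic.AdelicHeightGLProofs
import Literature.NumberTheory.Automorphic.AutomorphicFormsGLContinuous
import HarnessLib

/-!
# Uniform moderate growth of automorphic forms on `GL_n(𝔸_K)` from Harish-Chandra's
convolution identity (Borel–Jacquet 4.3 (ii), the moderate-growth step, proved from one named fact)

Topic `NumberTheory/Automorphic`. Let `φ` be an automorphic form on `GL_n(𝔸_K)` and
`X ∈ 𝔤 = 𝔤𝔩_n(K_∞)`. Granted Harish-Chandra's convolution identity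
`φ(g) = ∫_{GL_n(K_∞)} φ(g x) α(x) dx` with `α ∈ C_c^∞(GL_n(K_∞))`
(`AutomorphicRepsGL.exists_convolution_eq_self`, the named fact of `HarishChandraConvolutionGL`),
the Lie derivative is again a convolution, `(X φ)(g) = ∫ φ(g x) α_X(x) dx` with the continuous
compactly supported weight `α_X = -X̃ α` (`exists_hasDerivAt_left_translate`): substitute
`x ↦ exp(tX) x` (left invariance of the Haar measure) and differentiate under the integral sign
(dominated convergence). Since `1 ⊔ ‖g x‖ ≤ (1 ⊔ n ‖x‖) (1 ⊔ ‖g‖)`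
(`one_sup_adelicHeightGL_mul_le`) and the height `‖x‖ = H_∞(x)` is continuous on `GL_n(K_∞)`
(`continuous_adelicHeightGL_ofInfinite`), hence bounded on the support of `α_X`, the moderate
growth `‖φ(g)‖ ≤ C (1 ⊔ ‖g‖)^r` of `φ` gives `‖X φ(g)‖ ≤ C' (1 ⊔ ‖g‖)^r`: **`X φ` has moderate
growth** — Borel 1997, Prop. 5.2, Cor. 5.3 and 5.6 (c) ("`f` has uniform moderate growth");
Borel–Jacquet 1979, 4.3 (ii); Getz–Hahn 2024, Def. 6.4.

* `GLn.localHeight_ofInfinite`, `adelicHeightGL_ofInfinite`, `continuous_adelicHeightGL_ofInfinite`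
  — the height of an archimedean element is its (continuous) archimedean height;
* `lieDeriv_eq_integral_of_convolution` — `X φ = φ ∗ α_X` pointwise;
* `hasModerateGrowth_lieDeriv_of_convolution` — the moderate growth of `X φ`.

Everything here is proved (the convolution identity enters as a hypothesis).

## References

* A. Borel, *Automorphic forms on `SL₂(ℝ)`* (1997), Prop. 5.2, Cor. 5.3, 5.6 (c) [Borel1997].
* A. Borel, H. Jacquet, *Automorphic forms and automorphic representations*, Proc. Sympos. Pure
  Math. 33 (1979), part 1, §1.2 and 4.3 (ii) [BorelJacquet1979].
* J. R. Getz, H. Hahn, *An Introduction to Automorphic Representations* (2024), Def. 6.4, p. 117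
  [GetzHahn2024].
-/

noncomputable section

open scoped MatrixGroups Matrix ContDiff Topology Classical NNReal
open Filter MeasureTheory NumberField NumberField.mixedEmbedding IsDedekindDomain

namespace Literature.NumberTheory.Automorphic

variable {n : ℕ} {K : Type} [Field K] [NumberField K]

/-! ### The height of archimedean elements -/

section Height

/-- At every finite place the local height of an archimedean element `(x, 1) ∈ GL_n(𝔸_K)` is `1`
(`n ≥ 1`): its finite-adelic entries and those of its inverse are `δ_{ij} ∈ 𝒪_v`.
Borel–Jacquet 1979, §1.2. [cite: BorelJacquet1979, §1.2] -/
theorem GLn.localHeight_ofInfinite [NeZero n] (v : HeightOneSpectrum (𝓞 K))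
    (x : GL (Fin n) (mixedSpace K)) : GLn.localHeight n K v (GLn.ofInfinite n K x) = 1 := by
  have key : ∀ (y : GL (Fin n) (mixedSpace K)) (i j : Fin n),
      ((GLn.ofInfinite n K y : Matrix (Fin n) (Fin n) (AdeleRing (𝓞 K) K)) i j).2 v ∈
        v.adicCompletionIntegers K := by
    intro y i j
    rw [GLn.coe_ofInfinite_apply]
    change ((1 : Matrix (Fin n) (Fin n) (FiniteAdeleRing (𝓞 K) K)) i j) v ∈ _
    rw [Matrix.one_apply]
    split_ifs
    exacts [one_mem _, zero_mem _]
  refine le_antisymm (GLn.localHeight_le_one_of_forall_mem v _ (key x) fun i j => ?_)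
    (GLn.one_le_localHeight v _)
  rw [← map_inv]
  exact key x⁻¹ i j

/-- The archimedean height of the junk group `GL_0` vanishes. [folklore] -/
theorem GLn.archHeight_eq_zero_of_eq_zero (hn : n = 0) (g : GL (Fin n) (AdeleRing (𝓞 K) K)) :
    GLn.archHeight n K g = 0 := by
  subst hn
  unfold GLn.archHeight
  rw [Finset.univ_eq_empty, Finset.sup_empty]
  rfl

/-- **The height of an archimedean element is its archimedean height**:
`‖(x, 1)‖ = H_∞(x, 1)` (all finite local heights are `1`). Borel–Jacquet 1979, §1.2. [cite: BorelJacquet1979, §1.2] -/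
theorem adelicHeightGL_ofInfinite (x : GL (Fin n) (mixedSpace K)) :
    adelicHeightGL n K (GLn.ofInfinite n K x) = GLn.archHeight n K (GLn.ofInfinite n K x) := by
  rcases Nat.eq_zero_or_pos n with hn | hn
  · rw [adelicHeightGL_eq_zero_of_eq_zero hn, GLn.archHeight_eq_zero_of_eq_zero hn, NNReal.coe_zero]
  · haveI : NeZero n := ⟨hn.ne'⟩
    unfold adelicHeightGL
    rw [finprod_eq_one_of_forall_eq_one fun v => by rw [GLn.localHeight_ofInfinite, NNReal.coe_one],
      mul_one]

/-- **The height is continuous on `GL_n(K_∞)`**: `x ↦ ‖(x, 1)‖ = max_{i,j} (‖x_{ij}‖ ⊔ ‖(x⁻¹)_{ij}‖)`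
is continuous (entries of `x` and of `x⁻¹` depend continuously on `x` in the units topology).
Borel–Jacquet 1979, §1.2. [cite: BorelJacquet1979, §1.2] -/
theorem continuous_adelicHeightGL_ofInfinite :
    Continuous fun x : GL (Fin n) (mixedSpace K) => adelicHeightGL n K (GLn.ofInfinite n K x) := by
  simp only [adelicHeightGL_ofInfinite]
  refine NNReal.continuous_coe.comp ?_
  unfold GLn.archHeight
  simp only [GLn.toMixed_ofInfinite]
  refine Continuous.finset_sup_apply fun ij _ => ?_
  refine Continuous.sup ?_ ?_
  · exact (Units.continuous_val.matrix_elem ij.1 ij.2).nnnorm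
  · exact (Units.continuous_coe_inv.matrix_elem ij.1 ij.2).nnnorm

/-- On a compact subset of `GL_n(K_∞)` the height `‖(x, 1)‖` is bounded.
Borel–Jacquet 1979, §1.2. [cite: BorelJacquet1979, §1.2] -/
theorem exists_adelicHeightGL_ofInfinite_le_of_isCompact {S : Set (GL (Fin n) (mixedSpace K))}
    (hS : IsCompact S) : ∃ B : ℝ, 0 ≤ B ∧ ∀ x ∈ S, adelicHeightGL n K (GLn.ofInfinite n K x) ≤ B := by
  obtain ⟨B, hB⟩ := hS.exists_bound_of_continuousOn continuous_adelicHeightGL_ofInfinite.continuousOn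
  refine ⟨B ⊔ 0, le_sup_right, fun x hx => ?_⟩
  have h := hB x hx
  rw [Real.norm_of_nonneg (adelicHeightGL_nonneg _)] at h
  exact h.trans le_sup_left

end Height

/-! ### `X φ = φ ∗ α_X` and the moderate growth of `X φ` -/

section Growth

variable {hcpt : isCompact_glFiniteIntegralLevel n K}

attribute [local instance] glInfBorel borelSpace_glInf locallyCompactSpace_glInf
  secondCountableTopology_glInf

-- Mathlib idiom (Mathlib/Algebra/Lie/OfAssociative.lean); needed to mention Lie subalgebras of matrix algebras
attribute [local instance 100] LieRing.ofAssociativeRing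

set_option backward.isDefEq.respectTransparency false in
open scoped Matrix.Norms.Operator in
/-- **The Lie derivative of a convolution is the convolution with the derived weight.** Let `φ`
be an automorphic form on `GL_n(𝔸_K)`, `ν` a Haar measure on `GL_n(K_∞)`, `α ∈ C_c(GL_n(K_∞))`
with `φ(g) = ∫ φ(g x) α(x) dν(x)` for all `g`, and `α_X ∈ C_c(GL_n(K_∞))` with
`d/ds α(exp(-sX) x)|_{s=t} = α_X(exp(-tX) x)`. Then `(X φ)(g) = ∫ φ(g x) α_X(x) dν(x)`: by left
invariance `φ(g exp(tX)) = ∫ φ(g x) α(exp(-tX) x) dν(x)`, and one differentiates under the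
integral sign (the integrand has derivative `φ(g x) α_X(exp(-tX) x)`, dominated on `|t| < 1` by a
continuous compactly supported function). Borel 1997, Cor. 5.3 (1): `D(f ∗ α) = f ∗ Dα`.
[cite: Borel1997, Cor. 5.3] -/
theorem lieDeriv_eq_integral_of_convolution (ν : Measure (GL (Fin n) (mixedSpace K)))
    [ν.IsHaarMeasure] {φ : (AdelicGroupData.gl n K).Adelic → ℂ}
    (hφ : IsAutomorphicForm (AutomorphyDatum.gl n K hcpt) φ) {α αX : GL (Fin n) (mixedSpace K) → ℂ}
    (hαc : Continuous α) (hαs : HasCompactSupport α) (hαXc : Continuous αX)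
    (hαXs : HasCompactSupport αX) (X : Matrix (Fin n) (Fin n) (mixedSpace K))
    (hconv : ∀ g : GL (Fin n) (AdeleRing (𝓞 K) K), φ g = ∫ x, φ (g * GLn.ofInfinite n K x) * α x ∂ν)
    (hderiv : ∀ (x : GL (Fin n) (mixedSpace K)) (t : ℝ),
      HasDerivAt (fun s : ℝ => α ((expGL (s • X))⁻¹ * x)) (αX ((expGL (t • X))⁻¹ * x)) t)
    (g : GL (Fin n) (AdeleRing (𝓞 K) K)) :
    lieDeriv (AutomorphyDatum.gl n K hcpt).ofArch ⟨X, LieSubalgebra.mem_top X⟩ φ g =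
      ∫ x, φ (g * GLn.ofInfinite n K x) * αX x ∂ν := by
  have hφc : Continuous φ := hφ.continuous_gl
  have hφg : Continuous fun x : GL (Fin n) (mixedSpace K) => φ (g * GLn.ofInfinite n K x) :=
    hφc.comp (continuous_const.mul (GLn.continuous_ofInfinite n K))
  -- `s ↦ exp(sX)` and its inverse, as matrices
  have hexp_inv : ∀ s : ℝ, (((expGL (s • X))⁻¹ : GL (Fin n) (mixedSpace K)) :
      Matrix (Fin n) (Fin n) (mixedSpace K)) = NormedSpace.exp (s • (-X)) := fun s => by
    rw [← expGL_neg, coe_expGL, smul_neg]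
  have hexpc : Continuous fun s : ℝ => expGL (s • X) := by
    refine Units.continuous_iff.2 ⟨?_, ?_⟩
    · change Continuous fun s : ℝ => ((expGL (s • X) : GL (Fin n) (mixedSpace K)) :
        Matrix (Fin n) (Fin n) (mixedSpace K))
      simp only [coe_expGL]
      exact NormedSpace.exp_continuous.comp (continuous_id.smul continuous_const)
    · change Continuous fun s : ℝ => (((expGL (s • X))⁻¹ : GL (Fin n) (mixedSpace K)) :
        Matrix (Fin n) (Fin n) (mixedSpace K))
      simp only [hexp_inv]
      exact NormedSpace.exp_continuous.comp (continuous_id.smul continuous_const)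
  -- the parametrised integrand and its derivative
  set F : ℝ → GL (Fin n) (mixedSpace K) → ℂ := fun t x =>
    φ (g * GLn.ofInfinite n K x) * α ((expGL (t • X))⁻¹ * x) with hF_def
  set F' : ℝ → GL (Fin n) (mixedSpace K) → ℂ := fun t x =>
    φ (g * GLn.ofInfinite n K x) * αX ((expGL (t • X))⁻¹ * x) with hF'_def
  -- `φ(g exp(tX)) = ∫ F t`, by the convolution identity and left invariance of `ν`
  have hFt : ∀ t : ℝ, φ (g * GLn.ofInfinite n K (expGL (t • X))) = ∫ x, F t x ∂ν := by
    intro t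
    rw [hconv (g * GLn.ofInfinite n K (expGL (t • X))), hF_def]
    dsimp only
    conv_rhs => rw [← integral_mul_left_eq_self _ (expGL (t • X))]
    congr 1 with x
    rw [map_mul, inv_mul_cancel_left, mul_assoc]
  -- continuity of `F t`, `F' t` in `x`
  have hFc : ∀ t, Continuous (F t) := fun t =>
    hφg.mul (hαc.comp (continuous_const.mul continuous_id))
  have hF'c : ∀ t, Continuous (F' t) := fun t =>
    hφg.mul (hαXc.comp (continuous_const.mul continuous_id))
  -- a compact set carrying the supports of all `F' t`, `|t| ≤ 1`
  set S : Set (GL (Fin n) (mixedSpace K)) :=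
    (fun p : ℝ × GL (Fin n) (mixedSpace K) => expGL (p.1 • X) * p.2) '' (Set.Icc (-1) 1 ×ˢ tsupport αX)
    with hS_def
  have hS : IsCompact S :=
    (isCompact_Icc.prod hαXs).image ((hexpc.comp continuous_fst).mul continuous_snd)
  obtain ⟨M, hM⟩ := hαXs.exists_bound_of_continuous hαXc
  set bound : GL (Fin n) (mixedSpace K) → ℝ :=
    S.indicator fun x => ‖φ (g * GLn.ofInfinite n K x)‖ * M with hbound_def
  have hsupp : ∀ t ∈ Metric.ball (0 : ℝ) 1, ∀ x, ‖F' t x‖ ≤ bound x := by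
    intro t ht x
    rw [hF'_def, hbound_def]
    dsimp only
    by_cases hx : x ∈ S
    · rw [Set.indicator_of_mem hx, norm_mul]
      exact mul_le_mul_of_nonneg_left (hM _) (norm_nonneg _)
    · -- off `S` the derived weight vanishes
      have hzero : αX ((expGL (t • X))⁻¹ * x) = 0 := by
        by_contra hne
        apply hx
        refine ⟨(t, (expGL (t • X))⁻¹ * x), ⟨?_, subset_tsupport _ hne⟩, ?_⟩
        · rw [Metric.mem_ball, dist_zero_right, Real.norm_eq_abs, abs_lt] at ht
          exact ⟨ht.1.le, ht.2.le⟩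
        · dsimp only
          rw [mul_inv_cancel_left]
      rw [hzero, mul_zero, norm_zero, Set.indicator_of_notMem hx]
  have hbound_int : Integrable bound ν := by
    rw [hbound_def]
    exact ((hφg.norm.mul continuous_const).continuousOn.integrableOn_compact hS).integrable_indicator
      hS.measurableSet
  have hF0_int : Integrable (F 0) ν := by
    refine (hFc 0).integrable_of_hasCompactSupport ?_
    refine HasCompactSupport.mul_left ?_
    rw [zero_smul, expGL_zero, inv_one]
    simpa only [one_mul] using hαs
  have hdiff : ∀ x, ∀ t ∈ Metric.ball (0 : ℝ) 1, HasDerivAt (F · x) (F' t x) t := by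
    intro x t _
    exact (hderiv x t).const_mul (φ (g * GLn.ofInfinite n K x))
  -- differentiate under the integral sign at `t = 0`
  have hmain := hasDerivAt_integral_of_dominated_loc_of_deriv_le (μ := ν) (F := F) (F' := F')
    (x₀ := (0 : ℝ)) (bound := bound) (Metric.ball_mem_nhds (0 : ℝ) one_pos)
    (Eventually.of_forall fun t => (hFc t).aestronglyMeasurable) hF0_int
    ((hF'c 0).aestronglyMeasurable) (Eventually.of_forall fun x t ht => hsupp t ht x) hbound_int
    (Eventually.of_forall hdiff)
  -- identify the derivative at `0` with the Lie derivative
  set Xl : (AutomorphyDatum.gl n K hcpt).arch.lie := ⟨X, LieSubalgebra.mem_top X⟩ with hXl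
  have hdef : lieDeriv (AutomorphyDatum.gl n K hcpt).ofArch Xl φ g =
      deriv (fun t : ℝ => φ ((@id (AdelicGroupData.gl n K).Adelic g) *
        (AutomorphyDatum.gl n K hcpt).ofArch ((AutomorphyDatum.gl n K hcpt).arch.expMem (t • Xl)))) 0 :=
    rfl
  have hcurve : (fun t : ℝ => φ ((@id (AdelicGroupData.gl n K).Adelic g) *
        (AutomorphyDatum.gl n K hcpt).ofArch ((AutomorphyDatum.gl n K hcpt).arch.expMem (t • Xl)))) =
      fun t => ∫ x, F t x ∂ν := by
    funext t
    exact hFt t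
  rw [hdef, hcurve, hmain.2.deriv, hF'_def]
  simp only [zero_smul, expGL_zero, inv_one, one_mul]

/-- **`X φ` is a convolution with a continuous compactly supported weight**, granted
Harish-Chandra's convolution identity: for an automorphic form `φ` on `GL_n(𝔸_K)`, a Haar measure
`ν` on `GL_n(K_∞)` and `X ∈ 𝔤𝔩_n(K_∞)` there is `α_X ∈ C_c(GL_n(K_∞))` with
`(X φ)(g) = ∫ φ(g x) α_X(x) dν(x)` for all `g` (`exists_hasDerivAt_left_translate` and
`lieDeriv_eq_integral_of_convolution`). Borel 1997, Cor. 5.3; Borel–Jacquet 1979, 4.3 (ii).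
[cite: BorelJacquet1979, 4.3 (ii)] -/
theorem exists_weight_lieDeriv_eq_integral (hHC : AutomorphicRepsGL.exists_convolution_eq_self hcpt)
    (ν : Measure (GL (Fin n) (mixedSpace K))) [ν.IsHaarMeasure]
    {φ : (AdelicGroupData.gl n K).Adelic → ℂ} (hφ : IsAutomorphicForm (AutomorphyDatum.gl n K hcpt) φ)
    (X : (AutomorphyDatum.gl n K hcpt).arch.lie) :
    ∃ αX : GL (Fin n) (mixedSpace K) → ℂ, Continuous αX ∧ HasCompactSupport αX ∧
      ∀ g : GL (Fin n) (AdeleRing (𝓞 K) K),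
        lieDeriv (AutomorphyDatum.gl n K hcpt).ofArch X φ g =
          ∫ x, φ (g * GLn.ofInfinite n K x) * αX x ∂ν := by
  obtain ⟨α, hαc, hαs, hαsm, hconv⟩ := hHC ν φ hφ
  obtain ⟨αX, hαXc, hαXs, hderiv⟩ :=
    exists_hasDerivAt_left_translate (H := archGroupGL n K) (archGroupGL_lie n K) hαs hαsm
      (X : Matrix (Fin n) (Fin n) (mixedSpace K))
  have hX : (⟨(X : Matrix (Fin n) (Fin n) (mixedSpace K)), LieSubalgebra.mem_top _⟩ :
      (AutomorphyDatum.gl n K hcpt).arch.lie) = X := rfl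
  refine ⟨αX, hαXc, hαXs, fun g => ?_⟩
  rw [← hX]
  exact lieDeriv_eq_integral_of_convolution ν hφ hαc hαs hαXc hαXs _ hconv hderiv g

/-- **Moderate growth of Lie derivatives from the convolution identity** (Borel 1997, Prop. 5.2,
Cor. 5.3, 5.6 (c); Borel–Jacquet 1979, 4.3 (ii)): if Harish-Chandra's convolution identity
`AutomorphicRepsGL.exists_convolution_eq_self hcpt` holds, then for every automorphic form `φ` on
`GL_n(𝔸_K)` and `X ∈ 𝔤𝔩_n(K_∞)` the Lie derivative `X φ` has moderate growth:
`‖X φ(g)‖ ≤ ∫ ‖φ(g x)‖ ‖α_X(x)‖ dν(x) ≤ C (1 ⊔ n B)^r M ν(S) · (1 ⊔ ‖g‖)^r`, where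
`‖φ(h)‖ ≤ C (1 ⊔ ‖h‖)^r`, `S = supp α_X` is compact, `B` bounds the height on `S` and `M` bounds
`α_X`. [cite: BorelJacquet1979, 4.3 (ii)] -/
theorem hasModerateGrowth_lieDeriv_of_convolution
    (hHC : AutomorphicRepsGL.exists_convolution_eq_self hcpt)
    {φ : (AdelicGroupData.gl n K).Adelic → ℂ} (hφ : IsAutomorphicForm (AutomorphyDatum.gl n K hcpt) φ)
    (X : (AutomorphyDatum.gl n K hcpt).arch.lie) :
    HasModerateGrowth (AutomorphyDatum.gl n K hcpt)
      (lieDeriv (AutomorphyDatum.gl n K hcpt).ofArch X φ) := by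
  set ν : Measure (GL (Fin n) (mixedSpace K)) := Measure.haar with hν
  obtain ⟨αX, hαXc, hαXs, hint⟩ := exists_weight_lieDeriv_eq_integral hHC ν hφ X
  -- the constants
  obtain ⟨C, r, hCr⟩ := hφ.moderateGrowth
  have hCr' : ∀ h : GL (Fin n) (AdeleRing (𝓞 K) K), ‖φ h‖ ≤ C * (1 ⊔ adelicHeightGL n K h) ^ r :=
    fun h => hCr h
  set S := tsupport αX with hS_def
  have hS : IsCompact S := hαXs
  obtain ⟨B, hB0, hB⟩ := exists_adelicHeightGL_ofInfinite_le_of_isCompact (n := n) (K := K) hS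
  obtain ⟨M, hM⟩ := hαXs.exists_bound_of_continuous hαXc
  have hM0 : 0 ≤ M := (norm_nonneg _).trans (hM 1)
  have hC0 : 0 ≤ C := by
    have h := hCr' 1
    have hpos : (0 : ℝ) < (1 ⊔ adelicHeightGL n K 1) ^ r :=
      pow_pos (lt_of_lt_of_le one_pos le_sup_left) r
    exact nonneg_of_mul_nonneg_left ((norm_nonneg _).trans h) hpos
  set D : ℝ := 1 ⊔ n * B with hD_def
  have hD0 : 0 ≤ D := le_trans zero_le_one le_sup_left
  refine ⟨C * D ^ r * M * ν.real S, r, fun g₀ => ?_⟩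
  set g : GL (Fin n) (AdeleRing (𝓞 K) K) := g₀ with hg
  change ‖lieDeriv (AutomorphyDatum.gl n K hcpt).ofArch X φ g‖ ≤
    C * D ^ r * M * ν.real S * (1 ⊔ adelicHeightGL n K g) ^ r
  have hg1 : (0 : ℝ) < 1 ⊔ adelicHeightGL n K g := lt_of_lt_of_le one_pos le_sup_left
  set c : ℝ := C * (D * (1 ⊔ adelicHeightGL n K g)) ^ r * M with hc_def
  -- pointwise bound of the integrand
  have hptw : ∀ x, ‖φ (g * GLn.ofInfinite n K x) * αX x‖ ≤ S.indicator (fun _ => c) x := by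
    intro x
    by_cases hx : x ∈ S
    · rw [Set.indicator_of_mem hx, norm_mul, hc_def]
      refine mul_le_mul ?_ (hM x) (norm_nonneg _) (by positivity)
      refine (hCr' _).trans (mul_le_mul_of_nonneg_left ?_ hC0)
      refine pow_le_pow_left₀ (le_trans zero_le_one le_sup_left) ?_ r
      refine (one_sup_adelicHeightGL_mul_le g _).trans (mul_le_mul_of_nonneg_right ?_ hg1.le)
      exact sup_le_sup_left (mul_le_mul_of_nonneg_left (hB x hx) (Nat.cast_nonneg n)) _
    · have hzero : αX x = 0 := image_eq_zero_of_notMem_tsupport hx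
      rw [hzero, mul_zero, norm_zero, Set.indicator_of_notMem hx]
  -- integrate
  rw [hint g]
  refine (norm_integral_le_integral_norm _).trans ?_
  have hconst : Integrable (S.indicator fun _ : GL (Fin n) (mixedSpace K) => c) ν :=
    (integrableOn_const (C := c) (hs := hS.measure_lt_top.ne)).integrable_indicator hS.measurableSet
  refine (integral_mono_of_nonneg (Eventually.of_forall fun x => norm_nonneg _) hconst
    (Eventually.of_forall hptw)).trans ?_
  rw [integral_indicator_const _ hS.measurableSet, smul_eq_mul, hc_def, mul_pow]
  have : ν.real S * (C * (D ^ r * (1 ⊔ adelicHeightGL n K g) ^ r) * M) =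
      C * D ^ r * M * ν.real S * (1 ⊔ adelicHeightGL n K g) ^ r := by ring
  rw [this]

end Growth

end Literature.NumberTheory.Automorphic
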